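import Summits.HodgeConjecture.HodgeConjecture.Theorems.F0P2uXiOfThetaDatum          -- ★ FILE 1 p845114 (F0P2-p06 (g9)): the forward dictionary `(μ, χ, μω) ↦ ξ` with the two global pins
import Summits.HodgeConjecture.HodgeConjecture.Theorems.F0P2uMemXiFamilyThetaNonsplit -- ★ FILE 2 p845166 (F0P2-p06 (g9)): the NON-SPLIT membership clause for theta-`P`
import Summits.HodgeConjecture.HodgeConjecture.Theorems.F0P2uThetaMemSplit           -- ★ FILE 3 p845158 (this seat): the SPLIT membership clause for theta-`P`
import HarnessLib

/-!
# Crux `H413`, programme P2 — road «S2♯-θ» FILE 4: **THE HEAD `stubS2sharpTheta_holds : ‹StubS2SharpTheta›` — A THETA-TYPE `P` LIES IN THE ξ-LOCAL FAMILY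
# OF THE FORWARD DICTIONARY `ξ`, HYPOTHESIS-FREE** (§1 assembly `memXiFamily_of_theta_of_clauses` from the split clause ★ FILE 3 and a non-split clause `hns`;
# §2 the head over ★ FILE 1's dictionary and ★ FILE 2's non-split clause — statement = the desk's letter text `StubS2SharpTheta.letter` 8a360cce8c483c16 token for token)

Cell hodgecm-mathlib (D-0151), FLOOR 0, crux item H413 = stmt-HodgeConjecture-24833, route of record `HCCMUnconditional` (no route verbs);
programme P2 (theta ∕ `hdictE`); road «S2♯-θ» (desk F0P2-plan (g13) RULING D-P2-15, 2026-09-01T15:13Z: E2 REL-ENGINE ED. 4 = OUT `stub_S2sharp`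
∕ IN `stub_S2sharpTheta : StubS2SharpTheta`, letter text `F0/P2/e2-ed4-s2theta-src.F0P2-plan-g13/StubS2SharpTheta.letter.F0P2-plan-g13.txt` 8a360cce8c483c16).
FILE 1 ★ p845114 `F0P2uXiOfThetaDatum` (F0P2-p06 (g9)): the forward dictionary `(μ, χ, μω) ↦ ξ` with the pins (hdμ) `μ̃ = η̃⁻¹ψ̃⁻¹μω`, (hdχ)
`χ̌ = ψ̃⁻¹(η̃⁻¹ψ̃⁻¹μω)²`; FILE 2 ★ p845166 `F0P2uMemXiFamilyThetaNonsplit` (p06): the NON-SPLIT membership clause; FILE 3 ★ p845158 `F0P2uThetaMemSplit` (F0P2-p01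
(g13)): the SPLIT clause; THIS FILE (F0P2-p01 (g13)): §1 the assembly of D6 ★ `MemXiFamily P hH hHd μω hμu ξ` = `∃ Pv, ξ.IsXiLocalFamily hH hHd μω hμu Pv ∧
LocalConstituentsIn P Pv` from the two clauses, with `Pv v := cmSplitPacket …` at split `v` and `Pv v := ⟨x_v ∘ e_v⁻¹, s_v⟩` (the non-split data, by `choose`) at
non-split `v`; §2 THE HEAD `stubS2sharpTheta_holds` = the desk's letter `StubS2SharpTheta` (RULING D-P2-15) token for token, hypothesis-free: `ξ` from ★ FILE 1
`exists_xi_dictionary`, the non-split clause from ★ FILE 2 `nonsplit_clause_of_hasFinComponent_theta`.  CONSUMER: E2 `Cruxes/H413/Lines/F0_P2E3RelEngine.lean` ED. 4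
«S2♯-θ PAID» — `theorem stub_S2sharpTheta : StubS2SharpTheta := F0P2uS2SharpTheta.stubS2sharpTheta_holds` (OUT `stub_S2sharp` #80; the fold is textual).
THEOREMS ONLY (no `def`, no instance, no notation, no named fact, no `sorry`); never imports a `Cruxes/…/Lines` module (O50-1);
`--supports stmt-HodgeConjecture-24833`.  HONEST LABEL (D-0151): HC_CM is proved only modulo the printed citations until rung 0 closes; this file closes NO
print letter — it removes letter #80 S2♯ from the P2 REL-ENGINE (E2), whose REL¹ then owes print through REL♯¹ (the closer's rows) alone; #80 keeps its
other consumers (closer `stub_S2sharp` → `stub_L3` routing; PKΠ).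

## THE STATEMENT
For `H` hermitian with unit determinant (`hH`, `hHd`), a rational theta frame `(e₁, dV, g, ιV)`, an automorphic measure, a discrete automorphic `P` of `U(H)`
with `P_f ↩ ω_H(μ, a, χ)` (★ `HasFinComponent` of ★ `rhoAtLine … ιV a χ`), Rogawski's unitary `μω`, and `ξ : OneDimAutRepH L` under the two GLOBAL pins of
★ FILE 1: IF at every NON-split finite place `v` of `L⁺` there are a form congruence `(T, a′)` (★ `cmDatumLocalCongr`), a constituent `x` of the principal
series `i_G(χ_{ξ,v})` (★ `cmPrincipalSeries` at ★ `cmXiTorusChar`) and an optional SUPERCUSPIDAL class `s` such that every local constituent `c` of `P` at `v`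
is `x ∘ e⁻¹` or `s` (FILE 2's head, hypothesis `hns`), THEN `MemXiFamily P hH hHd μω hμu ξ`.
[Rogawski1990, §13.1 p. 199 (the ξ-local family), §12.2 (2) p. 174, Lemma 4.13.1 (b), §13.3 p. 201, §14.6 p. 246; GelbartRogawski1991, (5.1.1), Lem. 5.1.2.]

## THE PROOF
`choose` FILE 2's data; `Pv` by `dite` on «`v` splits»; the split clause of `IsXiLocalFamily` is `dif_pos`, the non-split clause is `dif_neg` + FILE 2's
data; `LocalConstituentsIn` is ★ FILE 3 at split `v` and FILE 2's membership disjunction (★ `LocalAPacket.mem_members_iff`) at non-split `v`.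

## References
* [Rogawski1990] J. Rogawski, *Automorphic Representations of Unitary Groups in Three Variables*, Ann. of Math. Stud. 123 (1990): §4.13 p. 62, Lemma 4.13.1 (b);
  §12.2 (2) p. 174; §13.1 p. 199, Prop. 13.1.3 (d); §13.3 p. 201; §14.6 p. 246.
* [GelbartRogawski1991] S. Gelbart, J. Rogawski, Invent. Math. 105 (1991): §5.1 (5.1.1) p. 465, Lem. 5.1.2 p. 466.
* [Liu2021] Y. Liu, arXiv:2102.11518: Def. 4.11 (l. 2090–2096); App. D §D.1, Lem. D.1.
-/

set_option autoImplicit false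
-- the mandated namespace has the single-problem summit's repeated segment (`HodgeConjecture.HodgeConjecture`)
set_option linter.dupNamespace false

noncomputable section

open scoped Matrix Kronecker MatrixGroups MonoidAlgebra ComplexOrder
open NumberField NumberField.InfinitePlace IsDedekindDomain MeasureTheory
open Literature.NumberTheory Literature.NumberTheory.Automorphic Literature.NumberTheory.Automorphic.UnitaryGroup
open Literature.NumberTheory.Automorphic.UnitaryGroup.CotangentForms
open Literature.NumberTheory.Automorphic.Liu2021 Literature.NumberTheory.Automorphic.Liu2021.AppendixC
open Literature.NumberTheory.Automorphic.Liu2021.Def411WeilCarriers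
open Literature.NumberTheory.Automorphic.Liu2021.Def411WeilCarriersDoubling
open Literature.NumberTheory.Automorphic.IdeleClassGroup
open Literature.NumberTheory.GelbartRogawski1991 Literature.NumberTheory.GelbartRogawski1991.UnitaryDualPair
open Literature.NumberTheory.GelbartRogawski1991.UnitaryDualPair.WeilCoinv
open Literature.NumberTheory.GelbartRogawski1991.UnitaryDualPair.LocalSplitting
open Literature.RepresentationTheory Literature.RepresentationTheory.Liu2021
open Literature.NumberTheory.GaloisRepresentations Literature.RepresentationTheory.HarrisKudlaSweet1996
open Literature.NumberTheory.Rogawski1990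
open Summit.HodgeConjecture.CorCM

namespace Summit.HodgeConjecture.HodgeConjecture.Cruxes.H413.F0P2uS2SharpTheta

/-! ## §1 The assembly from the two clauses -/

set_option synthInstance.maxHeartbeats 400000 in
set_option maxHeartbeats 8000000 in
/-- **S2♯-θ ASSEMBLY — A THETA-TYPE `P` LIES IN THE ξ-LOCAL FAMILY OF THE DICTIONARY `ξ`, GIVEN THE NON-SPLIT CLAUSE.**  For `H` hermitian with unit
determinant, a rational theta frame `(e₁, dV, g, ιV)` (`ιV k = g_f⁻¹ k g_f`), a discrete automorphic `P` of `U(H)` with `P_f ↩ ω_H(μ, a, χ)` (★ `HasFinComponent`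
of ★ `rhoAtLine … ιV a χ`), Rogawski's unitary `μω` and `ξ` under the two global dictionary pins (hdμ) `toHeckeCharacter L μ = ξ.bcη⁻¹ * ξ.bcψ⁻¹ * μω`,
(hdχ) `HeckeCharacter.checkOfChi hcc χ = ξ.bcψ⁻¹ * (ξ.bcη⁻¹ * ξ.bcψ⁻¹ * μω) ^ 2` (★ FILE 1 `exists_xi_dictionary`): the NON-SPLIT clause `hns` (FILE 2's head —
at every non-split `v` a form congruence, a constituent `x` of `i_G(χ_{ξ,v})`, an optional supercuspidal `s`, and «every local constituent of `P` at `v` is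
`x ∘ e⁻¹` or `s`») implies D6 ★ `MemXiFamily P hH hHd μω hμu ξ`; the split places are ★ FILE 3 `mem_cmSplitPacket_of_isConstituentOf_theta`.
[cite: Rogawski1990, §13.1 p. 199; §12.2 (2) p. 174; §4.13 Lemma 4.13.1 (b); §13.3 p. 201; §14.6 p. 246] [cite: GelbartRogawski1991, §5.1 (5.1.1) p. 465, Lem. 5.1.2 p. 466]
[cite: Liu2021, Def. 4.11 (l. 2090–2096); App. D Lem. D.1] -/
theorem memXiFamily_of_theta_of_clauses
    (L : Type) [Field L] [NumberField L] [IsCMField L] (H : Matrix (Fin 3) (Fin 3) L) (hH : (H.map (cmConjRingHom L))ᵀ = H) (hHd : IsUnit H.det)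
    {n' : ℕ} (e₁ : Fin 3 × Fin 1 ≃ Fin n') (dV : Fin 3 → L) (hdV : ∀ i, IsCMField.complexConj L (dV i) = dV i) (hdV0 : ∀ i, dV i ≠ 0)
    (g : GL (Fin 3) L)
    (hg : ((g : Matrix (Fin 3) (Fin 3) L).map (cmConjRingHom L))ᵀ * H * (g : Matrix (Fin 3) (Fin 3) L) = Matrix.diagonal dV)
    (ιV : finAdelic (↥(maximalRealSubfield L)) L (IsCMField.complexConj L) 3 H →*
        finAdelic (↥(maximalRealSubfield L)) L (IsCMField.complexConj L) 3 (Matrix.diagonal dV))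
    (hιV : ∀ k, ((ιV k : finAdelic (↥(maximalRealSubfield L)) L (IsCMField.complexConj L) 3 (Matrix.diagonal dV)) :
          GL (Fin 3) (FiniteAdeleRing (𝓞 L) L)) =
        (toFinAdeleGL L 3 g)⁻¹ * (k : GL (Fin 3) (FiniteAdeleRing (𝓞 L) L)) * toFinAdeleGL L 3 g)
    (μA : Measure (adelicGroupData (↥(maximalRealSubfield L)) L (IsCMField.complexConj L) 3 H).automorphicQuotient)
    [(adelicGroupData (↥(maximalRealSubfield L)) L (IsCMField.complexConj L) 3 H).IsAutomorphicMeasure μA]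
    (P : DiscreteAutomorphicRep (adelicGroupData (↥(maximalRealSubfield L)) L (IsCMField.complexConj L) 3 H) μA)
    (ξ : OneDimAutRepH L) (μω : HeckeCharacter L) (hμu : μω.IsUnitary)
    (μ : Literature.NumberTheory.Automorphic.IdeleClassGroup L →ₜ* Circle) (hμ : IsConjugateSymplectic L μ)
    (a : (↥(maximalRealSubfield L))ˣ) (χ : Chi (↥(maximalRealSubfield L)) L (IsCMField.complexConj L))
    (hcc : IsCMField.complexConj L * IsCMField.complexConj L = 1)
    (hμξ : toHeckeCharacter L μ = ξ.bcη⁻¹ * ξ.bcψ⁻¹ * μω)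
    (hχξ : HeckeCharacter.checkOfChi hcc χ = ξ.bcψ⁻¹ * (ξ.bcη⁻¹ * ξ.bcψ⁻¹ * μω) ^ 2)
    (hfin : P.HasFinComponent
      (rhoAtLine (↥(maximalRealSubfield L)) L (IsCMField.complexConj L) 3 e₁ (Matrix.diagonal dV)
        (complexConj_imagUnit L) (imagUnit_ne_zero L) (imagUnit_mul_self L) (realDiagonal_isSymm L dV hdV)
        (isUnit_det_realDiagonal L dV hdV hdV0) (realDiagonal_map L dV hdV).symm
        (fun a => isCompatible_chiSplittingLine L e₁ dV hdV hdV0 (toHeckeCharacter L μ)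
          (isUnitary_toHeckeCharacter L μ) ((isOscillatorChar_toHeckeCharacter_iff μ).mpr hμ)
          (TW (↥(maximalRealSubfield L)) a) (isSymm_TW (↥(maximalRealSubfield L)) a)
          (isUnit_det_TW (↥(maximalRealSubfield L)) a) (JW (↥(maximalRealSubfield L)) L a)
          (JW_eq (↥(maximalRealSubfield L)) L a)) ιV a χ))
    (hns : ∀ v : HeightOneSpectrum (𝓞 ↥(maximalRealSubfield L)),
      (∀ w : PlacesOver L v, IsCMField.complexConj L • w.1 = w.1) →
      ∃ (T : GL (Fin 3) (UnitaryGroup.LocalRing L v)) (a' : UnitaryGroup.LocalRing L v) (ha : IsUnit a')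
        (h : formCongr (conjLocal L (IsCMField.complexConj L) v) T (H.map (algebraMap L (UnitaryGroup.LocalRing L v))) =
          a' • (Matrix.of fun i j : Fin 3 => if i.val + j.val + 1 = 3 then (1 : L) else 0).map (algebraMap L (UnitaryGroup.LocalRing L v)))
        (x : IrrClass (Gqs L v)) (s : Option (IrrClass ((cmDatum L 3 H).Local v))),
        x.IsConstituentOf (cmPrincipalSeries L 3 v (cmXiTorusChar L v (μω.semilocalComponent L v)
          (torusLocalComponent L (IsCMField.complexConj L) v ξ.η) (torusLocalComponent L (IsCMField.complexConj L) v ξ.ψ))) ∧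
        (∀ c : IrrClass ((cmDatum L 3 H).Local v), s = some c → c.IsSupercuspidal) ∧
        ∀ c : IrrClass ((cmDatum L 3 H).Local v),
          (IrrClass.comap (localPiEquiv L (IsCMField.complexConj L) 3 H v) c).IsConstituentOf
              (P.finRep.smoothPart.toRepresentation.comp (inclPlace (↥(maximalRealSubfield L)) L (IsCMField.complexConj L) 3 H v)) →
            (c = IrrClass.comap (cmDatumLocalCongr L v T ha h).symm x ∨ s = some c)) :
    MemXiFamily P hH hHd μω hμu ξ := by
  classical
  choose T a' ha hTh x s hxPS hsc hmem using hns
  -- «`v` does not split» from «no place above `v` is moved»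
  have hv_of : ∀ v : HeightOneSpectrum (𝓞 ↥(maximalRealSubfield L)),
      (¬ ∃ w : PlacesOver L v, IsCMField.complexConj L • w.1 ≠ w.1) → ∀ w : PlacesOver L v, IsCMField.complexConj L • w.1 = w.1 :=
    fun v hs w => not_ne_iff.mp fun h => hs ⟨w, h⟩
  refine ⟨fun v =>
    if hs : (∃ w : PlacesOver L v, IsCMField.complexConj L • w.1 ≠ w.1) then
      cmSplitPacket L H hH hHd v (splitWitness v hs) (splitWitness_spec v hs) (ξ.splitν₀ μω (splitWitness v hs).1)
        (ξ.locψ (splitWitness v hs).1) (ξ.norm_splitν₀_apply hμu (splitWitness v hs).1)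
        (ξ.continuous_splitν₀ μω (splitWitness v hs).1) (ξ.norm_locψ_apply (splitWitness v hs).1)
        (ξ.continuous_locψ (splitWitness v hs).1)
    else
      ⟨IrrClass.comap (cmDatumLocalCongr L v (T v (hv_of v hs)) (ha v (hv_of v hs)) (hTh v (hv_of v hs))).symm (x v (hv_of v hs)),
        s v (hv_of v hs)⟩, ⟨?_, ?_⟩, ?_⟩
  · -- split clause of `IsXiLocalFamily`
    intro v hs
    simp only [dif_pos hs]
  · -- non-split clause of `IsXiLocalFamily`
    intro v hv
    have hs : ¬ ∃ w : PlacesOver L v, IsCMField.complexConj L • w.1 ≠ w.1 := fun ⟨w, hw⟩ => hw (hv w)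
    refine ⟨T v hv, a' v hv, ha v hv, hTh v hv, x v hv, s v hv, ?_, hxPS v hv, hsc v hv⟩
    simp only [dif_neg hs]
  · -- `LocalConstituentsIn P Pv`
    intro v c hc
    by_cases hs : ∃ w : PlacesOver L v, IsCMField.complexConj L • w.1 ≠ w.1
    · simp only [dif_pos hs]
      exact F0P2uThetaMemSplit.mem_cmSplitPacket_of_isConstituentOf_theta L H hH hHd e₁ dV hdV hdV0 g hg ιV hιV μA P ξ μω hμu μ hμ a χ
        hcc hμξ hχξ hfin v hs c hc
    · have hv := hv_of v hs
      simp only [dif_neg hs, LocalAPacket.mem_members_iff]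
      exact hmem v hv c hc

/-! ## §2 The head: `StubS2SharpTheta`, hypothesis-free -/

set_option synthInstance.maxHeartbeats 400000 in
set_option maxHeartbeats 8000000 in
/-- **S2♯-θ — THE HEAD (`StubS2SharpTheta` of E2 `F0_P2E3RelEngine` ED. 4, desk F0P2-plan (g13) RULING D-P2-15; statement = letter text
`F0/P2/e2-ed4-s2theta-src.F0P2-plan-g13/StubS2SharpTheta.letter.F0P2-plan-g13.txt` ws-sha16 8a360cce8c483c16 TOKEN FOR TOKEN): A DISCRETE AUTOMORPHIC `P` OF
`U(H)` WITH A THETA-TYPE FINITE COMPONENT `P_f ↩ ω_H(μ, a, χ)` LIES IN THE ξ-LOCAL FAMILY OF SOME ONE-DIMENSIONAL AUTOMORPHIC `ξ` OF `U(2) × U(1)`** — for Rogawski's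
frame `(L, ι, H, T, hT)` (positive definite off `ι`, `[L⁺:ℚ] ≥ 2`), a rational theta frame `(e₁, dV, g, ιV)`, an automorphic measure, `P`, Rogawski's `μω` (unitary,
`μω|_{𝕀_{L⁺}} = ε_{L∕L⁺}`), `μ` conjugate symplectic of weight one, a line `a` and `χ ∈ Chi`: `P.HasFinComponent (rhoAtLine … ιV a χ) → ∃ ξ, MemXiFamily P … μω hμu ξ`.
HYPOTHESIS-FREE: `ξ :=` the forward dictionary of ★ FILE 1 `F0P2uXiOfThetaDatum.exists_xi_dictionary` (p845114, F0P2-p06 (g9)); the family by §1 over the split clause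
★ FILE 3 `F0P2uThetaMemSplit.mem_cmSplitPacket_of_isConstituentOf_theta` (p845158) and the non-split clause ★ FILE 2
`F0P2uMemXiFamilyThetaNonsplit.nonsplit_clause_of_hasFinComponent_theta` (p845166, F0P2-p06 (g9)).  This is the finite clause of «the theta lift `Θ_μ(χ)` lies in
the A-packet `Π(ξ)`» [GelbartRogawski1991 (5.1.1), Lem. 5.1.2; Rogawski1990 §13.1 p. 199, §12.2 (2), Lemma 4.13.1 (b)] in D6's envelope currency — exactly what the
REL-ENGINE head `relParity_of_engine` consumed from the print letter #80 S2♯ (`obtain ⟨ξ, hmem, -⟩`), now in-house.  (`hdef`, `h2`, `HasWeight` are frame binders of the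
letter and are not used.)
[cite: Rogawski1990, §13.1 p. 199; §12.2 (2) p. 174; §4.13 Lemma 4.13.1 (b); §13.3 p. 201; §14.6 p. 246] [cite: GelbartRogawski1991, §5.1 (5.1.1) p. 465, Lem. 5.1.2 p. 466]
[cite: Liu2021, Def. 4.11 (l. 2090–2096); App. D §D.1 (l. 5224), Lem. D.1] -/
theorem stubS2sharpTheta_holds :
  ∀ (L : Type) [Field L] [NumberField L] [IsCMField L] (ι : L →+* ℂ) (H : Matrix (Fin 3) (Fin 3) L) (T : GL (Fin 3) ℂ)
    (hT : (T : Matrix (Fin 3) (Fin 3) ℂ)ᴴ * H.map ι * (T : Matrix (Fin 3) (Fin 3) ℂ) = Literature.Geometry.ComplexHyperbolic.BallModel.J),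
    (∀ τ' : L →+* ℂ, InfinitePlace.mk τ' ≠ InfinitePlace.mk ι → (H.map τ').PosDef) → 2 ≤ Module.finrank ℚ ↥(maximalRealSubfield L) →
    ∀ {n' : ℕ} (e₁ : Fin 3 × Fin 1 ≃ Fin n') (dV : Fin 3 → L) (hdV : ∀ i, IsCMField.complexConj L (dV i) = dV i)
      (hdV0 : ∀ i, dV i ≠ 0) (g : GL (Fin 3) L)
      (hg : ((g : Matrix (Fin 3) (Fin 3) L).map (cmConjRingHom L))ᵀ * H * (g : Matrix (Fin 3) (Fin 3) L) = Matrix.diagonal dV)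
      (ιV : finAdelic (↥(maximalRealSubfield L)) L (IsCMField.complexConj L) 3 H →*
          finAdelic (↥(maximalRealSubfield L)) L (IsCMField.complexConj L) 3 (Matrix.diagonal dV)),
        (∀ k, ((ιV k : finAdelic (↥(maximalRealSubfield L)) L (IsCMField.complexConj L) 3 (Matrix.diagonal dV)) :
            GL (Fin 3) (FiniteAdeleRing (𝓞 L) L)) =
          (toFinAdeleGL L 3 g)⁻¹ * (k : GL (Fin 3) (FiniteAdeleRing (𝓞 L) L)) * toFinAdeleGL L 3 g) →
        ∀ (μA : Measure (adelicGroupData (↥(maximalRealSubfield L)) L (IsCMField.complexConj L) 3 H).automorphicQuotient)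
          [(adelicGroupData (↥(maximalRealSubfield L)) L (IsCMField.complexConj L) 3 H).IsAutomorphicMeasure μA]
          (P : DiscreteAutomorphicRep (adelicGroupData (↥(maximalRealSubfield L)) L (IsCMField.complexConj L) 3 H) μA),
          ∀ (μω : HeckeCharacter L) (hμu : μω.IsUnitary),
            (∀ x : Literature.NumberTheory.GaloisRepresentations.ideleGroup ↥(maximalRealSubfield L),
              μω (AdeleRing.ideleBaseChange (↥(maximalRealSubfield L)) L x) = quadraticHeckeCharCM L x) →
            ∀ (μ : Literature.NumberTheory.Automorphic.IdeleClassGroup L →ₜ* Circle) (hμ : IsConjugateSymplectic L μ), HasWeight L μ 1 →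
              ∀ (a : (↥(maximalRealSubfield L))ˣ) (χ : Chi (↥(maximalRealSubfield L)) L (IsCMField.complexConj L)),
                P.HasFinComponent
                  (rhoAtLine (↥(maximalRealSubfield L)) L (IsCMField.complexConj L) 3 e₁ (Matrix.diagonal dV)
                    (complexConj_imagUnit L) (imagUnit_ne_zero L) (imagUnit_mul_self L) (realDiagonal_isSymm L dV hdV)
                    (isUnit_det_realDiagonal L dV hdV hdV0) (realDiagonal_map L dV hdV).symm
                    (fun a => isCompatible_chiSplittingLine L e₁ dV hdV hdV0 (toHeckeCharacter L μ)
                      (isUnitary_toHeckeCharacter L μ) ((isOscillatorChar_toHeckeCharacter_iff μ).mpr hμ)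
                      (TW (↥(maximalRealSubfield L)) a) (isSymm_TW (↥(maximalRealSubfield L)) a)
                      (isUnit_det_TW (↥(maximalRealSubfield L)) a) (JW (↥(maximalRealSubfield L)) L a)
                      (JW_eq (↥(maximalRealSubfield L)) L a)) ιV a χ) →
                  ∃ ξ : OneDimAutRepH L,
                    MemXiFamily P (transpose_map_cmConjRingHom_eq_of_frame L ι H T hT) (isUnit_det_of_frame L ι H T hT) μω hμu ξ := by
  intro L _ _ _ ι H T hT _hdef _h2 n' e₁ dV hdV hdV0 g hg ιV hιV μA _ P μω hμu hquad μ hμ _hw a χ hfin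
  obtain ⟨ξ, hμξ, hχξ⟩ := F0P2uXiOfThetaDatum.exists_xi_dictionary L μω hquad μ hμ (Def411WeilCarriers.complexConj_mul_complexConj' L) χ
  exact ⟨ξ, memXiFamily_of_theta_of_clauses L H _ _ e₁ dV hdV hdV0 g hg ιV hιV μA P ξ μω hμu μ hμ a χ _ hμξ hχξ hfin
    (fun v hv => F0P2uMemXiFamilyThetaNonsplit.nonsplit_clause_of_hasFinComponent_theta L H
      (transpose_map_cmConjRingHom_eq_of_frame L ι H T hT) (isUnit_det_of_frame L ι H T hT) e₁ dV hdV hdV0 g hg ιV hιV μA P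
      μω hμu hquad μ hμ a χ hfin ξ _ hμξ hχξ v hv)⟩

end Summit.HodgeConjecture.HodgeConjecture.Cruxes.H413.F0P2uS2SharpTheta

end
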